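import Summits.QuantumFields.YangMills.Theorems.UnitScaleTiltProp7GeodesicBlend
import HarnessLib

/-!
# Route `UnitScaleTilt`, crux K1 child «MinimiserStabilityRegPr» (stmt-QuantumFields-19200), registered stub `stub_prop7From14` (skeleton birth_v7
# cc37a178…; leaf V3 «Prop 7 from a background (14)») — THE BLENDED BOND VARIABLE: for the geodesic trilinear blend `B` of `Prop7GeodesicBlend` with the
# arc of `Prop7GeodesicInterp`, `‖B(t; v)·W_b·B(t⁺; v⁺)⁻¹·U₀,b⁻¹ − 1‖ ≤ 1600·|t − t⁺|₁·D + 4096·ρ` when the eight inputs move along the bond by one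
# two-sided translation up to `ρ` and are pairwise `D`-close

Cell `ym3-torus` ∕ fleet seat `ym-ust-19200-p1` (gen 9; HUMAN RULING D-0037, YM ladder rung R3).  WHY.  Brick 4 of the blended-comb-gauge line
(CARD-19200-V3-g9.md): the group-side core of the sup bound of the blended (4)-representative on EVERY bond.  At a bond `b = ⟨z, μ⟩` the gauge
transformation of the line is `g(z) = B(t(z); v(z))`, `g(z + e_μ) = B(t⁺; v⁺)` with `v⁺_ε = U₀,b⁻¹·r_ε⁻¹·v_ε·W_b`, `dist1(r_ε) ≤ ρ` (`Prop7BlendCells` (E1)),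
the two eight-tuples pairwise `D`-close (`Prop7BlendCells` (E2)) and `|t − t⁺|₁ = L^{−k}`; then the bond variable of `W^g` relative to `U₀` is
`B(t; v)·B(t⁺; r⁻¹v)*` by the EQUIVARIANCE of the blend, and the two Lipschitz bounds of `Prop7GeodesicBlend` give the estimate.  This file instantiates
the abstract scheme `G` of `Prop7GeodesicBlend` with the geodesic arc `G_t(a,b) = exp(t·log(ba*))·a` (hypotheses discharged by `Prop7GeodesicInterp`) and
proves the bond estimate in closed form, on `U(N)` with the `SU(N)`-membership rider.

WHAT IS PROVED (sorry-free, no definition).  `arc_hmem`, `arc_hmemSU`, `arc_hnear`, `arc_hlip`, `arc_hpert`, `arc_hconj`, `arc_h0`, `arc_h1` (the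
hypotheses of `Prop7GeodesicBlend` for the arc, in its binder shapes); **`blend_bond_le`** (the displayed estimate).

HONEST SCOPE.  Elementary; count-neutral helper toward stmt-QuantumFields-19200 (`--supports`).

References: T. Bałaban, CMP 102 (1985) 277–309 [Balaban1985Variational] ((4) p.278, (18) p.280); CMP 99 (1985) 75–102 [Balaban1985RegularSpaces]
(Lemma 1 p.79); CMP 98 (1985) 17–51 [Balaban1985Averaging] ((8) p.18, (19)–(27) pp.21–22).
-/

noncomputable section

open NormedSpace
open scoped Matrix.Norms.L2Operator

namespace Summit.QuantumFields.YangMills.Theorems.Prop7BlendBond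

open Literature.MathematicalPhysics.QuantumFieldTheory.Balaban1983to89
open MatrixLog (mlog)
open Summit.QuantumFields.YangMills.Theorems.Prop7GeodesicInterp
open Summit.QuantumFields.YangMills.Theorems.Prop7GeodesicBlend

variable {n : Type*} [Fintype n] [DecidableEq n] [Nonempty n]

/-! ## §1 The arc satisfies the hypotheses of the abstract blend -/

omit [Nonempty n] in
/-- `hmem` for the arc. [cite: Balaban1985Averaging, (23) p.21] -/
theorem arc_hmem : ∀ (t : ℝ) (a b : Matrix n n ℂ), a ∈ Matrix.unitaryGroup n ℂ → b ∈ Matrix.unitaryGroup n ℂ → ‖b * star a - 1‖ ≤ 1 / 3 →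
    exp (((t : ℂ)) • mlog (b * star a)) * a ∈ Matrix.unitaryGroup n ℂ :=
  fun t _ _ ha hb hab => arc_mem_unitaryGroup ha hb hab t

omit [Nonempty n] in
/-- `hmemSU` for the arc. [cite: Balaban1985Averaging, (23) p.21] -/
theorem arc_hmemSU : ∀ (t : ℝ) (a b : Matrix n n ℂ), a ∈ Matrix.specialUnitaryGroup n ℂ → b ∈ Matrix.specialUnitaryGroup n ℂ →
    ‖b * star a - 1‖ ≤ 1 / 3 → Fintype.card n * ‖b * star a - 1‖ < Real.pi →
    exp (((t : ℂ)) • mlog (b * star a)) * a ∈ Matrix.specialUnitaryGroup n ℂ :=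
  fun t _ _ ha hb hab hπ => arc_mem_specialUnitaryGroup ha hb hab hπ t

omit [Nonempty n] in
/-- `hnear` for the arc. [cite: Balaban1985Averaging, (24)-(27) pp.21-22] -/
theorem arc_hnear : ∀ (t : ℝ) (a b : Matrix n n ℂ), a ∈ Matrix.unitaryGroup n ℂ → b ∈ Matrix.unitaryGroup n ℂ → ‖b * star a - 1‖ ≤ 1 / 3 →
    |t| ≤ 1 → ‖exp (((t : ℂ)) • mlog (b * star a)) * a * star a - 1‖ ≤ 6 * |t| * ‖b * star a - 1‖ :=
  fun _ _ _ ha hb hab ht => norm_arc_mul_star_sub_one_le ha hb hab ht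

omit [Nonempty n] in
/-- `hlip` for the arc. [cite: Balaban1985Averaging, (24)-(27) pp.21-22] -/
theorem arc_hlip : ∀ (t s : ℝ) (a b : Matrix n n ℂ), a ∈ Matrix.unitaryGroup n ℂ → b ∈ Matrix.unitaryGroup n ℂ → ‖b * star a - 1‖ ≤ 1 / 3 →
    |t - s| ≤ 1 → ‖exp (((t : ℂ)) • mlog (b * star a)) * a * star (exp (((s : ℂ)) • mlog (b * star a)) * a) - 1‖ ≤
      6 * |t - s| * ‖b * star a - 1‖ :=
  fun _ _ _ _ ha hb hab hts => norm_arc_mul_star_arc_sub_one_le ha hb hab hts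

/-- `hpert` for the arc. [cite: Balaban1985Averaging, (21)-(27) pp.21-22] -/
theorem arc_hpert : ∀ (t : ℝ) (a b p q : Matrix n n ℂ), a ∈ Matrix.unitaryGroup n ℂ → b ∈ Matrix.unitaryGroup n ℂ →
    p ∈ Matrix.unitaryGroup n ℂ → q ∈ Matrix.unitaryGroup n ℂ → ‖b * star a - 1‖ ≤ 1 / 6 → ‖p - 1‖ ≤ 1 / 16 → ‖q - 1‖ ≤ 1 / 16 →
    0 ≤ t → t ≤ 1 → ‖exp (((t : ℂ)) • mlog ((q * b) * star (p * a))) * (p * a) * star (exp (((t : ℂ)) • mlog (b * star a)) * a) - 1‖ ≤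
      8 * (‖p - 1‖ + ‖q - 1‖) :=
  fun _ _ _ _ _ ha hb hp hq hab hp1 hq1 ht0 ht1 => norm_arc_perturb_le ha hb hp hq hab hp1 hq1 ht0 ht1

omit [Nonempty n] in
/-- `hconj` for the arc. [cite: Balaban1985Averaging, Sect. B p.24] -/
theorem arc_hconj : ∀ (t : ℝ) (u w a b : Matrix n n ℂ), u ∈ Matrix.unitaryGroup n ℂ → w ∈ Matrix.unitaryGroup n ℂ →
    exp (((t : ℂ)) • mlog ((u * b * w) * star (u * a * w))) * (u * a * w) = u * (exp (((t : ℂ)) • mlog (b * star a)) * a) * w :=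
  fun t _ _ a b hu hw => arc_conj hu hw a b t

omit [Nonempty n] in
/-- `h0` for the arc. [folklore] -/
theorem arc_h0 : ∀ a b : Matrix n n ℂ, exp ((((0 : ℝ) : ℂ)) • mlog (b * star a)) * a = a := arc_zero

omit [Nonempty n] in
/-- `h1` for the arc. [cite: Balaban1985Averaging, (21) p.21] -/
theorem arc_h1 : ∀ a b : Matrix n n ℂ, a ∈ Matrix.unitaryGroup n ℂ → ‖b * star a - 1‖ < 1 → exp ((((1 : ℝ) : ℂ)) • mlog (b * star a)) * a = b :=
  fun _ _ ha hab => arc_one ha hab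

/-! ## §2 The bond estimate -/

/-- **THE BLENDED BOND VARIABLE.**  `G` the geodesic arc; `v, v⁺` two families of eight unitaries, each pairwise `D`-close, `D ≤ 1/1600`; `W_b`, `U₀,b`
unitary with `‖v_ε·W_b·(v⁺_ε)*·U₀,b* − 1‖ ≤ ρ ≤ 1/4096` for every corner (the transport law of `Prop7BlendCells` (E1)); weights `t, t⁺ ∈ [0,1]³`.  Then
`‖B(t; v)·W_b·B(t⁺; v⁺)*·U₀,b* − 1‖ ≤ 1600·(|t₁ − t⁺₁| + |t₂ − t⁺₂| + |t₃ − t⁺₃|)·D + 4096·ρ`.  (Equivariance: `B(t⁺; v⁺) = U₀,b*·B(t⁺; p·v)·W_b` with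
`p_ε = U₀,b v⁺_ε W_b* v_ε*`, `‖p_ε − 1‖ ≤ ρ`; then `Prop7GeodesicBlend.blend_lip_weights` and `blend_lip_inputs`.)
[cite: Balaban1985Variational, (18) p.280; Balaban1985RegularSpaces, Lemma 1 p.79; Balaban1985Averaging, (8) p.18] -/
theorem blend_bond_le (v w : Fin 2 → Fin 2 → Fin 2 → Matrix n n ℂ) (hv : ∀ i j k, v i j k ∈ Matrix.unitaryGroup n ℂ)
    (hw : ∀ i j k, w i j k ∈ Matrix.unitaryGroup n ℂ) {D : ℝ} (hD : D ≤ 1 / 1600)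
    (hvv : ∀ i j k i' j' k', ‖v i j k * star (v i' j' k') - 1‖ ≤ D) (hww : ∀ i j k i' j' k', ‖w i j k * star (w i' j' k') - 1‖ ≤ D)
    {Wb Ub : Matrix n n ℂ} (hWb : Wb ∈ Matrix.unitaryGroup n ℂ) (hUb : Ub ∈ Matrix.unitaryGroup n ℂ) {ρ : ℝ} (hρ : ρ ≤ 1 / 4096)
    (htr : ∀ i j k, ‖v i j k * Wb * star (w i j k) * star Ub - 1‖ ≤ ρ)
    {t₁ t₂ t₃ s₁ s₂ s₃ : ℝ} (h₁0 : 0 ≤ t₁) (h₁1 : t₁ ≤ 1) (h₂0 : 0 ≤ t₂) (h₂1 : t₂ ≤ 1) (h₃0 : 0 ≤ t₃) (h₃1 : t₃ ≤ 1)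
    (hs₁0 : 0 ≤ s₁) (hs₁1 : s₁ ≤ 1) (hs₂0 : 0 ≤ s₂) (hs₂1 : s₂ ≤ 1) (hs₃0 : 0 ≤ s₃) (hs₃1 : s₃ ≤ 1) :
    let G : ℝ → Matrix n n ℂ → Matrix n n ℂ → Matrix n n ℂ := fun t a b => exp (((t : ℂ)) • mlog (b * star a)) * a
    ‖G t₃ (G t₂ (G t₁ (v 0 0 0) (v 1 0 0)) (G t₁ (v 0 1 0) (v 1 1 0))) (G t₂ (G t₁ (v 0 0 1) (v 1 0 1)) (G t₁ (v 0 1 1) (v 1 1 1))) * Wb *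
        star (G s₃ (G s₂ (G s₁ (w 0 0 0) (w 1 0 0)) (G s₁ (w 0 1 0) (w 1 1 0))) (G s₂ (G s₁ (w 0 0 1) (w 1 0 1)) (G s₁ (w 0 1 1) (w 1 1 1)))) *
        star Ub - 1‖ ≤ 1600 * (|t₁ - s₁| + |t₂ - s₂| + |t₃ - s₃|) * D + 4096 * ρ := by
  intro G
  -- the perturbation `p_ε = U₀,b v⁺_ε W_b* v_ε*` and the rewriting `v⁺_ε = U₀,b*·(p_ε v_ε)·W_b`
  set p : Fin 2 → Fin 2 → Fin 2 → Matrix n n ℂ := fun i j k => Ub * w i j k * star Wb * star (v i j k) with hp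
  have hpU : ∀ i j k, p i j k ∈ Matrix.unitaryGroup n ℂ := fun i j k =>
    Submonoid.mul_mem _ (Submonoid.mul_mem _ (Submonoid.mul_mem _ hUb (hw i j k)) (Unitary.star_mem hWb)) (Unitary.star_mem (hv i j k))
  have hwrite : ∀ i j k, w i j k = star Ub * (p i j k * v i j k) * Wb := by
    intro i j k
    simp only [hp, mul_assoc, Unitary.star_mul_self_of_mem (hv i j k), Unitary.star_mul_self_of_mem hWb, mul_one]
    rw [← mul_assoc, Unitary.star_mul_self_of_mem hUb, one_mul]
  have hpv : ∀ i j k, p i j k * v i j k ∈ Matrix.unitaryGroup n ℂ := fun i j k => Submonoid.mul_mem _ (hpU i j k) (hv i j k)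
  -- `‖p_ε − 1‖ ≤ ρ`
  have hp1 : ∀ i j k, ‖(p i j k * v i j k) * star (v i j k) - 1‖ ≤ ρ := by
    intro i j k
    rw [udist_left_mul (hv i j k)]
    have : p i j k = star (v i j k * Wb * star (w i j k) * star Ub) := by
      simp only [hp, star_mul, star_star, mul_assoc]
    rw [this, ExpMeanLog.norm_star_sub_one]
    exact htr i j k
  -- the `p·v` family is pairwise `D`-close (it is a two-sided unitary translate of `v⁺`)
  have hpvv : ∀ i j k i' j' k', ‖(p i j k * v i j k) * star (p i' j' k' * v i' j' k') - 1‖ ≤ D := by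
    intro i j k i' j' k'
    have e1 : p i j k * v i j k = Ub * w i j k * star Wb := by
      rw [hwrite i j k]; simp only [mul_assoc, Unitary.mul_star_self_of_mem hWb, mul_one]
      rw [← mul_assoc, ← mul_assoc, Unitary.mul_star_self_of_mem hUb, one_mul]
    have e2 : p i' j' k' * v i' j' k' = Ub * w i' j' k' * star Wb := by
      rw [hwrite i' j' k']; simp only [mul_assoc, Unitary.mul_star_self_of_mem hWb, mul_one]
      rw [← mul_assoc, ← mul_assoc, Unitary.mul_star_self_of_mem hUb, one_mul]
    rw [e1, e2, udist_conj hUb (Unitary.star_mem hWb)]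
    exact hww i j k i' j' k'
  -- equivariance: `B(s; v⁺) = U₀,b* · B(s; p v) · W_b`
  have hB : G s₃ (G s₂ (G s₁ (w 0 0 0) (w 1 0 0)) (G s₁ (w 0 1 0) (w 1 1 0))) (G s₂ (G s₁ (w 0 0 1) (w 1 0 1)) (G s₁ (w 0 1 1) (w 1 1 1))) =
      star Ub * G s₃ (G s₂ (G s₁ (p 0 0 0 * v 0 0 0) (p 1 0 0 * v 1 0 0)) (G s₁ (p 0 1 0 * v 0 1 0) (p 1 1 0 * v 1 1 0)))
        (G s₂ (G s₁ (p 0 0 1 * v 0 0 1) (p 1 0 1 * v 1 0 1)) (G s₁ (p 0 1 1 * v 0 1 1) (p 1 1 1 * v 1 1 1))) * Wb := by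
    have h := blend_conj G arc_hconj (Unitary.star_mem hUb) hWb (fun i j k => p i j k * v i j k) s₁ s₂ s₃
    simp only [← hwrite] at h
    exact h
  rw [hB]
  -- `B(t;v)·W_b·(U₀,b*·B′·W_b)*·U₀,b* = B(t;v)·B′*`
  have hsimp : ∀ X Y : Matrix n n ℂ, X * Wb * star (star Ub * Y * Wb) * star Ub = X * star Y := by
    intro X Y
    simp only [star_mul, star_star, mul_assoc]
    rw [← mul_assoc Wb (star Wb), Unitary.mul_star_self_of_mem hWb, one_mul, Unitary.mul_star_self_of_mem hUb, mul_one]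
  rw [hsimp]
  -- triangle: change the weights, then the inputs
  obtain ⟨-, -, -, -, hBt⟩ := blend_mem_unitaryGroup G arc_hmem arc_hnear v hv (hD.trans (by norm_num)) hvv t₃ h₁0 h₁1 h₂0 h₂1
  obtain ⟨-, -, -, -, hBs⟩ := blend_mem_unitaryGroup G arc_hmem arc_hnear v hv (hD.trans (by norm_num)) hvv s₃ hs₁0 hs₁1 hs₂0 hs₂1
  have hweights := blend_lip_weights G arc_hmem arc_hnear arc_hlip arc_hpert v hv hD hvv h₁0 h₁1 h₂0 h₂1 h₃0 h₃1 hs₁0 hs₁1 hs₂0 hs₂1 hs₃0 hs₃1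
  have hinputs := blend_lip_inputs G arc_hmem arc_hnear arc_hpert v (fun i j k => p i j k * v i j k) hv hpv (hD.trans (by norm_num)) hvv hpvv hρ
    hp1 hs₁0 hs₁1 hs₂0 hs₂1 hs₃0 hs₃1
  rw [udist_symm] at hinputs
  linarith [udist_triangle hBt hBs
    (G s₃ (G s₂ (G s₁ (p 0 0 0 * v 0 0 0) (p 1 0 0 * v 1 0 0)) (G s₁ (p 0 1 0 * v 0 1 0) (p 1 1 0 * v 1 1 0)))
      (G s₂ (G s₁ (p 0 0 1 * v 0 0 1) (p 1 0 1 * v 1 0 1)) (G s₁ (p 0 1 1 * v 0 1 1) (p 1 1 1 * v 1 1 1))))]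

end Summit.QuantumFields.YangMills.Theorems.Prop7BlendBond

end
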